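import Literature.InformationTheory.Coding.LinearSpherePackingBound
import Literature.InformationTheory.QuantumCodes.CSSStabilizer
import HarnessLib

/-!
# CSS table cells `(14,0)`, `(15,0)`, `(16,0)`, UPPER column from the classical linear-code bounds: the zero-rate CSS
# distances `4, 4, 5` of the css-n16 table are optimal (the three cells CLOSE in the kernel)

LADDER-QEC (venture cell `qec`), CENSUS-PREREG C.2 extension `13 ≤ n ≤ 16` (qec-search-5 g2's COMPUTED table
census/search-5/css-n16/CSS-CALIB.tsv; qec-type-02 g5's kernel columns census/type-02/CSS16-KERNEL-ROWS.tsv (LOWER: the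
instances `Census/CSS/CalibCSSK0N13to16.lean`, `isAdditiveCode_css_n14_k0 : [[14,0,4]]`, `…_n15_k0 : [[15,0,4]]`,
`…_n16_k0 : [[16,0,5]]`, CRSS `k = 0` convention) and CSS16-UPPER-CELLS.tsv (UPPER so far: `cssUpperLP_14_0 : ≤ 5`,
`cssUpperLP_15_0 : ≤ 5` by CSS-LP Farkas certificates, `cssUpper_16_0 : ≤ 6` from the additive bound — one above the
instance: the three cells were OPEN in the kernel, and OPEN (gap 1) in search-5 g2's table; search-5 g3 closed them by a
COMPUTED exhaustive classification of binary `[14..16, k, ≥ 5/6]` codes, kit j272547, plus the printed `n_L(7) = 11`).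

This file closes them in the KERNEL, with no enumeration: a zero-rate CSS code on `n` qubits is a pair of classical codes
`A = rs H^X`, `B = rs H^Z` with `dim A + dim B = n` (`CSSCode.finrank_toSympCode_add_k`, `k = 0`), and every nonzero word
of `A` or `B` is a nonzero stabilizer `(a|0)` / `(0|b)` of the same weight; so if all nonzero stabilizers have weight `≥ D`,
both `A` and `B` are binary LINEAR codes of length `n` and minimum distance `≥ D`, and the classical dimension bounds
`B(n, D) ≤ 2^K` with `2K < n` are contradicted (**`css_exists_stabilizer_lt_of_linear_bound`**). The classical inputs are
qec-type-02's `Literature/InformationTheory/Coding/LinearSpherePackingBound.lean` (sphere packing for linear codes + one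
Griesmer step, MacWilliams–Sloane Ch. 1 Thm. 6 (28), Ch. 17 Thm. 23 (51); the values are those of Ch. 18 §7.3 (20),
`n_L(7) = 11`, Helgert–Stinaff 1973): `finrank_le_of_minDist_14_5` (`[14,k,≥5] ⇒ k ≤ 6`), `finrank_le_of_minDist_15_5`
(`[15,k,≥5] ⇒ k ≤ 7`), `finrank_le_of_minDist_16_6` (`[16,k,≥6] ⇒ k ≤ 7`). Cells (tier KERNEL-std, axioms standard, no
`decide` on codes):

* **`cssUpperLin_14_0`** — every zero-rate CSS code on `14` qubits has a nonzero stabilizer of weight `≤ 4`;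
* **`cssUpperLin_15_0`** — every zero-rate CSS code on `15` qubits has a nonzero stabilizer of weight `≤ 4`;
* **`cssUpperLin_16_0`** — every zero-rate CSS code on `16` qubits has a nonzero stabilizer of weight `≤ 5`.

With the LOWER instances these three cells are theorems in BOTH columns (best zero-rate CSS distance at `n = 14, 15, 16`
EXACTLY `4, 4, 5`), so the css-n16 kernel table is closed in `147` of its `153` cells `n ≤ 16`; still OPEN in the kernel
(gap 1): (13,3), (14,3), (15,1), (15,3), (15,4), (16,1). HONEST FRAMING: the corresponding ADDITIVE cells are better
(`[[14,0,6]]`, `[[15,0,6]]`, `[[16,0,6]]` exist, CRSS Table III): this is a CSS-vs-stabilizer gap, and classically it is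
the linear-vs-nonlinear gap of the Nordstrom–Robinson code (`A(16,6) = 256 > 128 ≥ B(16,6)`). [folklore] throughout; the
classical values are MacWilliams–Sloane's [cite: MacWilliamsSloane1977, Ch. 18 §7.3 eq. (20) (held chunk p0457); Ch. 17 §5
Thm. 23 (51) (chunk p0429); Ch. 1 §5 Thm. 6 (28) (chunk p0027)].
-/

namespace Summit.Ventures.QEC.Census.CSS

open Module Literature.InformationTheory.QuantumCodes Literature.InformationTheory.Coding

/-! ## Generic transport: classical dimension bounds for both stabilizer spans bound every zero-rate CSS code -/

/-- For a zero-rate CSS code on `n` qubits the two stabilizer spans have complementary dimensions: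
`dim rs H^X + dim rs H^Z = n` (`dim S̄ + k = n` with `k = 0`, `dim S̄ = rank H^X + rank H^Z`). [folklore] -/
theorem css_finrank_rowSpX_add_finrank_rowSpZ {n : ℕ} {RX RZ : Type*} [Fintype RX] [Fintype RZ]
    (C : CSSCode RX RZ (Fin n)) (hk : C.k = 0) :
    finrank (ZMod 2) C.rowSpX + finrank (ZMod 2) C.rowSpZ = n := by
  have h1 := C.finrank_toSympCode_add_k
  rw [hk, add_zero, C.finrank_toSympCode] at h1
  rw [finrank_rowSpace_eq_rank, finrank_rowSpace_eq_rank]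
  exact h1

/-- If every nonzero stabilizer of a CSS code has weight `≥ D`, then every nonzero word of the `X`-span `rs H^X` has
weight `≥ D` (it is the stabilizer `(a|0)`, of weight `wt a`). [folklore] -/
theorem css_le_hammingNorm_of_mem_rowSpX {n : ℕ} {RX RZ : Type*} [Fintype RX] [Fintype RZ]
    (C : CSSCode RX RZ (Fin n)) {D : ℕ} (hall : ∀ v ∈ C.toSympCode, v ≠ 0 → D ≤ sympWeight v) :
    ∀ a ∈ C.rowSpX, a ≠ 0 → D ≤ hammingNorm a := by
  intro a ha ha0
  have hmem : ((a, 0) : SympVec n) ∈ C.toSympCode := (C.mem_toSympCode_iff _).2 ⟨ha, Submodule.zero_mem _⟩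
  have hne : ((a, 0) : SympVec n) ≠ 0 := fun h => ha0 (congrArg Prod.fst h)
  have h := hall _ hmem hne
  rwa [sympWeight_mk_zero_snd] at h

/-- If every nonzero stabilizer of a CSS code has weight `≥ D`, then every nonzero word of the `Z`-span `rs H^Z` has
weight `≥ D` (it is the stabilizer `(0|b)`, of weight `wt b`). [folklore] -/
theorem css_le_hammingNorm_of_mem_rowSpZ {n : ℕ} {RX RZ : Type*} [Fintype RX] [Fintype RZ]
    (C : CSSCode RX RZ (Fin n)) {D : ℕ} (hall : ∀ v ∈ C.toSympCode, v ≠ 0 → D ≤ sympWeight v) :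
    ∀ b ∈ C.rowSpZ, b ≠ 0 → D ≤ hammingNorm b := by
  intro b hb hb0
  have hmem : ((0, b) : SympVec n) ∈ C.toSympCode := (C.mem_toSympCode_iff _).2 ⟨Submodule.zero_mem _, hb⟩
  have hne : ((0, b) : SympVec n) ≠ 0 := fun h => hb0 (congrArg Prod.snd h)
  have h := hall _ hmem hne
  rwa [sympWeight_mk_zero_fst] at h

/-- **Classical dimension bounds close zero-rate CSS cells.** If every binary linear code of length `n` whose nonzero
words have weight `≥ D` has dimension `≤ K` (`B(n, D) ≤ 2^K`) and `2K < n`, then every zero-rate CSS code on `n` qubits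
has a nonzero stabilizer of weight `< D` (else `rs H^X`, `rs H^Z` would both be such codes, of total dimension `n`).
[folklore] -/
theorem css_exists_stabilizer_lt_of_linear_bound {n D K : ℕ}
    (hlin : ∀ A : Submodule (ZMod 2) (Fin n → ZMod 2), (∀ x ∈ A, x ≠ 0 → D ≤ hammingNorm x) →
      finrank (ZMod 2) A ≤ K)
    (hK : 2 * K < n) {RX RZ : Type*} [Fintype RX] [Fintype RZ] (C : CSSCode RX RZ (Fin n)) (hk : C.k = 0) :
    ∃ v ∈ C.toSympCode, v ≠ 0 ∧ sympWeight v < D := by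
  by_contra hcon
  push Not at hcon
  have hX := hlin C.rowSpX (css_le_hammingNorm_of_mem_rowSpX C hcon)
  have hZ := hlin C.rowSpZ (css_le_hammingNorm_of_mem_rowSpZ C hcon)
  have hsum := css_finrank_rowSpX_add_finrank_rowSpZ C hk
  omega

/-! ## The three cells -/

/-- Cell `(n, k) = (14, 0)`: every zero-rate CSS code on `14` qubits has a nonzero stabilizer of weight `≤ 4` (CRSS `k = 0`
convention) — no binary linear `[14, ≥ 7, 5]` code (`finrank_le_of_minDist_14_5`), while `dim rs H^X + dim rs H^Z = 14`.
With `isAdditiveCode_css_n14_k0 : [[14,0,4]]` the cell is CLOSED: best zero-rate CSS distance on `14` qubits `= 4`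
(additive: `6`). [folklore] -/
theorem cssUpperLin_14_0 {RX RZ : Type*} [Fintype RX] [Fintype RZ] (C : CSSCode RX RZ (Fin 14)) (hk : C.k = 0) :
    ∃ v ∈ C.toSympCode, v ≠ 0 ∧ sympWeight v ≤ 4 := by
  obtain ⟨v, hv, hv0, hlt⟩ := css_exists_stabilizer_lt_of_linear_bound (n := 14) (D := 5) (K := 6)
    (fun A hA => finrank_le_of_minDist_14_5 (Fintype.card_fin 14) A hA) (by norm_num) C hk
  exact ⟨v, hv, hv0, Nat.lt_succ_iff.1 hlt⟩

/-- Cell `(n, k) = (15, 0)`: every zero-rate CSS code on `15` qubits has a nonzero stabilizer of weight `≤ 4` (CRSS `k = 0`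
convention) — no binary linear `[15, ≥ 8, 5]` code (`finrank_le_of_minDist_15_5`), while `dim rs H^X + dim rs H^Z = 15`.
With `isAdditiveCode_css_n15_k0 : [[15,0,4]]` the cell is CLOSED: best zero-rate CSS distance on `15` qubits `= 4`
(additive: `6`). [folklore] -/
theorem cssUpperLin_15_0 {RX RZ : Type*} [Fintype RX] [Fintype RZ] (C : CSSCode RX RZ (Fin 15)) (hk : C.k = 0) :
    ∃ v ∈ C.toSympCode, v ≠ 0 ∧ sympWeight v ≤ 4 := by
  obtain ⟨v, hv, hv0, hlt⟩ := css_exists_stabilizer_lt_of_linear_bound (n := 15) (D := 5) (K := 7)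
    (fun A hA => finrank_le_of_minDist_15_5 (Fintype.card_fin 15) A hA) (by norm_num) C hk
  exact ⟨v, hv, hv0, Nat.lt_succ_iff.1 hlt⟩

/-- Cell `(n, k) = (16, 0)`: every zero-rate CSS code on `16` qubits has a nonzero stabilizer of weight `≤ 5` (CRSS `k = 0`
convention) — no binary linear `[16, ≥ 8, 6]` code (`finrank_le_of_minDist_16_6`), while `dim rs H^X + dim rs H^Z = 16`.
With `isAdditiveCode_css_n16_k0 : [[16,0,5]]` the cell is CLOSED: best zero-rate CSS distance on `16` qubits `= 5`
(additive: `6`). [folklore] -/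
theorem cssUpperLin_16_0 {RX RZ : Type*} [Fintype RX] [Fintype RZ] (C : CSSCode RX RZ (Fin 16)) (hk : C.k = 0) :
    ∃ v ∈ C.toSympCode, v ≠ 0 ∧ sympWeight v ≤ 5 := by
  obtain ⟨v, hv, hv0, hlt⟩ := css_exists_stabilizer_lt_of_linear_bound (n := 16) (D := 6) (K := 7)
    (fun A hA => finrank_le_of_minDist_16_6 (Fintype.card_fin 16) A hA) (by norm_num) C hk
  exact ⟨v, hv, hv0, Nat.lt_succ_iff.1 hlt⟩

end Summit.Ventures.QEC.Census.CSS
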